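import Mathlib
import HarnessLib
import Literature.AlgebraicGeometry.Ramification.InertiaStalkNormalSylow
import Literature.AlgebraicGeometry.Resolution.BlowupStalkCharts
import Literature.AlgebraicGeometry.Resolution.BlowupStalkEmbedding
import Literature.AlgebraicGeometry.Resolution.StalkIdealLemmas
import Literature.AlgebraicGeometry.Resolution.PrimeDivisorIdeals
import Literature.AlgebraicGeometry.Resolution.AffineBlowupCartier
import Summits.ResolutionOfSingularities.ResolutionOfSingularities.Theorems.WildQuotientsWildQuotientResolutionStubInertiaLe
import Summits.ResolutionOfSingularities.ResolutionOfSingularities.Theorems.WildQuotientsWildQuotientResolutionStubPointBlowupStalkData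

/-!
# Local data of an equivariant blow-up of a STABLE CENTRE, at a point over the centre (crux `WildQuotients.WildQuotientResolution`, Phase 0)

Crux stmt-ResolutionOfSingularities-15640 (`WildQuotientResolution`), line `Sketch` (card
`p-closure-sylow-separation`), registered stub `stub_phaseZeroHighDim` (= PhaseZeroModel for
`dim X′ ≥ 3`). `PointBlowupStalkData.stub_pointBlowupStalkData`
(`Theorems/…StubPointBlowupStalkData.lean`) extracts, for the blow-up of the reduced ideal of a
FINITE set of closed points, the local package at a point `x` over the centre that the surface
engine `BorelCore.stub_borelCore` consumes (`J = 𝔪_z`). Phase 0 from dimension `3` on also blows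
up positive-dimensional `G`-stable centres (the regularised curves of non-p-closed inertia), and
its engine `FlagStep.hasNormalSylow_of_blowupStep` (`Theorems/…FlagStep.lean`) consumes the same
package for an ARBITRARY centre ideal `J = 𝒥_z` TOGETHER WITH its stability under the inertia.
This file generalises the extraction accordingly:

**Theorem** (`centreBlowupStalkData`). Let `π : X♯ → X′` be a blowing up of the integral locally
Noetherian `X′` along an ideal sheaf `𝒥` stable under a faithful action `ρ` of the finite group
`G` over the affine `q` (`𝒥.comap (ρ g) = 𝒥`), lifted to `X♯` with `π` equivariant, and `x ∈ X♯`,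
`z = π x`, `I = I_x`. Then with `R = 𝒪_{X′,z}`, `S = 𝒪_{X♯,x}`, `ι = π♯_x`, `J = 𝒥_z`
(`stalkIdeal`): `I` acts on `R` and `S` by ring automorphisms `τ`, `τ₁` with `τ` injective,
`ι ∘ τ_g = τ₁_g ∘ ι`, `τ₁` residue-trivial, `τ_g(J) ⊆ J`; `J S = (ι t)` for some `t ∈ J`; and
`ι` is injective.

The only new point is the stability `τ_g(J) ⊆ J`: the stalk endomorphism `a_g` of
`PointBlowupStalkData.exists_stalkAction` is pinned down by `Spec(a_g) ≫ ι_z = ι_z ≫ ρ g` to be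
`stalkSpecializes ≫ (ρ g)♯_z` (`ι_z` a monomorphism), and both factors preserve the stalks of `𝒥`
(`stalkIdeal_map_stalkSpecializes`, `stalkIdeal_comap_eq_map_stalkMap` with `𝒥.comap (ρ g) = 𝒥`).

[OURS · crux stmt-ResolutionOfSingularities-15640 · helper toward `stub_phaseZeroHighDim`; folklore
plumbing, counted 0; AI-level work, weaker than expert review.]
-/

-- single-problem summit: the doubled namespace component `ResolutionOfSingularities` is forced
set_option linter.dupNamespace false

namespace Summit.ResolutionOfSingularities.ResolutionOfSingularities.Theorems.WildQuotientResolution.CentreBlowupStalkData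

open CategoryTheory AlgebraicGeometry TopologicalSpace IsLocalRing
open Literature.AlgebraicGeometry.Resolution Literature.AlgebraicGeometry.Ramification
open Summit.ResolutionOfSingularities.ResolutionOfSingularities.Theorems.WildQuotientResolution.PointBlowupStalkData

/-- **The local data of an equivariant blow-up of a stable centre, at a point over the centre** —
the hypotheses of `FlagStep.hasNormalSylow_of_blowupStep` except the ones on the outer flag
pieces. Let `π : X♯ → X′` be a blowing up (`IsBlowup`) of the integral locally Noetherian `X′`
along the ideal sheaf `𝒥`, `G` acting on `X′` faithfully over the affine `q` with `𝒥` stable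
(`𝒥.comap (ρ g) = 𝒥`) and on `X♯` with `π` equivariant, `x ∈ X♯`, `z = π x`, `I = I_x ≤ G` its
inertia group. Then with `R = 𝒪_{X′,z}`, `S = 𝒪_{X♯,x}`, `ι = π♯_x`, `J = 𝒥_z`: `I` acts on `R`
and on `S` by ring automorphisms `τ`, `τ₁` with `τ` injective, `ι ∘ τ_g = τ₁_g ∘ ι`, `τ₁`
residue-trivial and `τ_g(J) ⊆ J`; `J S = (ι t)` for some `t ∈ J`; and `ι` is injective. The case
`𝒥 = 𝓘_Z`, `Z` a finite set of closed points (`J = 𝔪_z`) is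
`PointBlowupStalkData.stub_pointBlowupStalkData`.
[folklore; cf. StacksProject, Tag 0804; AbbesSaito2011, 2.4] -/
theorem centreBlowupStalkData {X' X₁ : Scheme.{0}} (q : X' ⟶ X₁) [IsAffineHom q]
    {G : Type} [Group G] [Finite G] (ρ : G →* Aut X') (hfaith : Function.Injective ρ)
    (hρ : ∀ g : G, (ρ g).hom ≫ q = q) [IsIntegral X'] [IsLocallyNoetherian X']
    (𝒥 : X'.IdealSheafData) (h𝒥 : ∀ g : G, 𝒥.comap (ρ g).hom = 𝒥)
    {Xs : Scheme.{0}} {π : Xs ⟶ X'} (hπ : IsBlowup π 𝒥) [IsIntegral Xs]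
    (ρs : G →* Aut Xs) (hequiv : ∀ g : G, (ρs g).hom ≫ π = π ≫ (ρ g).hom) (x : Xs) :
    ∃ (τ : inertiaSubgroup ρs x →*
          (X'.presheaf.stalk (π.base x) ≃+* X'.presheaf.stalk (π.base x)))
      (τ₁ : inertiaSubgroup ρs x →* (Xs.presheaf.stalk x ≃+* Xs.presheaf.stalk x))
      (t : X'.presheaf.stalk (π.base x)),
      Function.Injective τ ∧
      (∀ (g : inertiaSubgroup ρs x) (r : X'.presheaf.stalk (π.base x)),
        (π.stalkMap x).hom (τ g r) = τ₁ g ((π.stalkMap x).hom r)) ∧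
      (∀ (g : inertiaSubgroup ρs x) (s : Xs.presheaf.stalk x),
        τ₁ g s - s ∈ maximalIdeal (Xs.presheaf.stalk x)) ∧
      (∀ (g : inertiaSubgroup ρs x), ∀ j ∈ stalkIdeal 𝒥 (π.base x),
        τ g j ∈ stalkIdeal 𝒥 (π.base x)) ∧
      t ∈ stalkIdeal 𝒥 (π.base x) ∧
      Ideal.map (π.stalkMap x).hom (stalkIdeal 𝒥 (π.base x)) =
        Ideal.span {(π.stalkMap x).hom t} ∧
      Function.Injective (π.stalkMap x).hom := by
  classical
  -- `I_x ≤ I_z`: every element of `I = I_x` fixes `x` and `z = π x`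
  have hle : inertiaSubgroup ρs x ≤ inertiaSubgroup ρ (π.base x) :=
    InertiaLe.stub_inertia_le ρs ρ π hequiv x
  have hfixb : ∀ h : inertiaSubgroup ρs x, (ρ (h : G)).hom.base (π.base x) = π.base x :=
    fun h => apply_eq_of_mem_inertiaSubgroup ρ (hle h.2)
  -- the actions on `S = 𝒪_{X♯,x}` and on `R = 𝒪_{X′,z}`
  obtain ⟨a, τ₁, hkeya, hτa⟩ := exists_stalkAction ρs x (inertiaSubgroup ρs x)
    (fun g hg => apply_eq_of_mem_inertiaSubgroup ρs hg)
  obtain ⟨b, τ, hkeyb, hτb⟩ := exists_stalkAction ρ (π.base x) (inertiaSubgroup ρs x)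
    (fun g hg => apply_eq_of_mem_inertiaSubgroup ρ (hle hg))
  -- generators of the stalk `J = 𝒥_z` of the centre, and a chart of the blow-up through `x`
  obtain ⟨k, c, hc⟩ := exists_fin_span_eq_stalkIdeal 𝒥 (π.base x)
  obtain ⟨j, 𝔴, χ, hχ, -, -⟩ := hπ.exists_reesChart_stalk x c hc
  -- compatibility of the two actions with `ι = π^♯_x`: cancel the monomorphism
  -- `Spec 𝒪_{X′,z} → X′`
  have hcompat : ∀ h : inertiaSubgroup ρs x, b h ≫ π.stalkMap x = π.stalkMap x ≫ a h := by
    intro h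
    apply Spec.map_injective
    rw [← cancel_mono (X'.fromSpecStalk (π.base x))]
    simp only [Spec.map_comp, Category.assoc, hkeyb, Scheme.SpecMap_stalkMap_fromSpecStalk,
      Scheme.SpecMap_stalkMap_fromSpecStalk_assoc]
    rw [reassoc_of% (hkeya h), hequiv]
  -- the stalk endomorphism `b h` is `stalkSpecializes ≫ (ρ h)♯_z` (same cancellation)
  have hb : ∀ h : inertiaSubgroup ρs x,
      b h = X'.presheaf.stalkSpecializes (specializes_of_eq (hfixb h)) ≫
        (ρ (h : G)).hom.stalkMap (π.base x) := by
    intro h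
    apply Spec.map_injective
    rw [← cancel_mono (X'.fromSpecStalk (π.base x)), hkeyb, Spec.map_comp, Category.assoc,
      Scheme.SpecMap_stalkSpecializes_fromSpecStalk, Scheme.SpecMap_stalkMap_fromSpecStalk]
  refine ⟨τ, τ₁, c j, ?_, ?_, ?_, ?_, ?_, ?_, hπ.stalkMap_injective x⟩
  · -- `τ` is injective: the action is faithful on the local scheme `Spec 𝒪_{X′,z} → X′`
    rw [injective_iff_map_eq_one]
    intro g hg
    have h1 : b g⁻¹ = 𝟙 _ := by
      ext y
      have := RingEquiv.congr_fun hg y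
      rw [hτb] at this
      simpa using this
    have h2 : X'.fromSpecStalk (π.base x) ≫ (ρ ((g⁻¹ : inertiaSubgroup ρs x) : G)).hom =
        X'.fromSpecStalk (π.base x) := by
      rw [← hkeyb, h1, Spec.map_id, Category.id_comp]
    have h3 : ((g⁻¹ : inertiaSubgroup ρs x) : G) = 1 :=
      eq_one_of_fromSpecStalk_comp_eq ρ q hρ hfaith (π.base x) _ h2
    have : (g⁻¹ : inertiaSubgroup ρs x) = 1 := Subtype.ext h3
    exact inv_eq_one.mp this
  · -- compatibility with `ι`
    intro g r
    rw [hτb, hτa, ← CommRingCat.comp_apply, ← CommRingCat.comp_apply, hcompat]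
  · -- `τ₁` is residue-trivial: `Spec κ(x) → X♯` is fixed by the elements of `I_x`
    intro g s
    rw [hτa]
    set k : inertiaSubgroup ρs x := g⁻¹
    have hk : Xs.fromSpecResidueField x ≫ (ρs (k : G)).hom = Xs.fromSpecResidueField x :=
      (mem_inertiaSubgroup_iff ρs).mp k.2
    have hk' : a k ≫ Xs.residue x = Xs.residue x := by
      apply Spec.map_injective
      rw [Spec.map_comp, ← cancel_mono (Xs.fromSpecStalk x), Category.assoc, hkeya,
        ← Category.assoc]
      exact hk
    have hval : (Xs.residue x).hom ((a k).hom s) = (Xs.residue x).hom s := by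
      rw [← CommRingCat.comp_apply, hk']
    rw [← residue_eq_zero_iff, map_sub, sub_eq_zero]
    exact hval
  · -- `τ_g (J) ⊆ J`: `b h = stalkSpecializes ≫ (ρ h)♯_z` and both preserve the stalks of `𝒥`
    intro g r hr
    rw [hτb, hb, CommRingCat.hom_comp, RingHom.comp_apply]
    set h : inertiaSubgroup ρs x := g⁻¹
    have h1 : (X'.presheaf.stalkSpecializes (specializes_of_eq (hfixb h))).hom r ∈
        stalkIdeal 𝒥 ((ρ (h : G)).hom.base (π.base x)) := by
      rw [← stalkIdeal_map_stalkSpecializes 𝒥 (specializes_of_eq (hfixb h))]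
      exact Ideal.mem_map_of_mem _ hr
    have h2 := Ideal.mem_map_of_mem ((ρ (h : G)).hom.stalkMap (π.base x)).hom h1
    rw [← stalkIdeal_comap_eq_map_stalkMap, h𝒥] at h2
    exact h2
  · -- `t = c_j ∈ J`
    rw [← hc]
    exact Ideal.subset_span (Set.mem_range_self j)
  · -- `J S = (ι c_j)`: `S` is a localisation of the chart `R[J/c_j]`, on which `J`
    -- generates `(c_j)`
    have h1 : (Ideal.span (Set.range c)).map (chartBase c j) = Ideal.span {chartBase c j (c j)} :=
      span_image_reesChartBase_eq (c j) _
    have h2 : (π.stalkMap x).hom = χ.comp (chartBase c j) := (RingHom.ext hχ).symm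
    rw [← hc, h2, RingHom.comp_apply, ← Ideal.map_map, h1, Ideal.map_span,
      Set.image_singleton]

end Summit.ResolutionOfSingularities.ResolutionOfSingularities.Theorems.WildQuotientResolution.CentreBlowupStalkData
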